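import Summits.ValiantsHypothesis.ValiantsHypothesis.Theorems.KPlusLogSqLawTropicalBNewtonPolygon

/-!
# Route «KPlusLogSqLaw», crux `TropicalB` (stmt-ValiantsHypothesis-19771) — the BALLOT LAW for the steps of a dominant chain:
# no signed integer relation among the step vectors of a chain has ballot (Dyck-prefix) coefficients

HONEST FRAMING.  Helper file (cell `pub-symmetroid`, seat val-sym-trop-p1 g32, 2026-08-29; Newton-polygon docket) `--supports` the crux
`Summit.ValiantsHypothesis.ValiantsHypothesis.Theses.KPlusLogSqLaw.TropicalB` (item `stmt-ValiantsHypothesis-19771`, registered stubs `stub_tropThin` /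
`stub_tropFat` of `Cruxes/TropicalB/Lines/birth.lean`).  An all-design STRUCTURE LAW (every format, every exponent vector, every support), def-free;
it bounds no census row and asserts nothing about `TropicalB` in its window, `WeakLifting`, DoorA26 / DoorA34, `MatrixDescartes` (stmt-ValiantsHypothesis-18050)
or VP ≠ VNP.

SETTING.  An abstract sandwiched lattice chain `(Θ, S, C) : ℕ → ℤ` on `[0, n]` (`Θ i < Θ (i+1)`, `Θ i·ΔSᵢ < ΔCᵢ < Θ (i+1)·ΔSᵢ`; `…TropicalBLatticeChain`,
`NewtonPolygon.sandwich`): along a dominant chain of a design `S` = total exponent, `C` = valuation sum of the terms.  A COEFFICIENT SEQUENCE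
`ν : ℕ → ℤ` on the `n` steps is BALLOT (for the chain) if the weighted prefix sums `W j = Σ_{k ≤ j} ν k · ΔS_k` are `≥ 0` for `j < n` and `W (n−1) = 0`
(on a unit-step chain, `ΔS ≡ 1`: the plain prefix sums of `ν` are `≥ 0` with total `0` — a signed Dyck / ballot sequence).

CONTENT (namespace `BallotLaw`).
* §1 `abel_prefix` (Abel summation with explicit prefix sums), `abel_neg` (**strict Abel inequality**: prefix sums `≥ 0`, last `= 0`, not all weights zero,
  against a strictly increasing sequence ⇒ `Σ w_k θ_k < 0`), `exists_prefix_pos`.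
* §2 **BALLOT LAW** `ballot_law`: for a sandwiched chain and a ballot `ν` that is not identically zero on the steps, `Σ_{k<n} ν k · ΔC_k < 0`; hence
  `no_ballot_relation`: `Σ ν k · ΔC_k = 0` is impossible — in particular (`Design.no_ballot_relation`) the STEP VECTORS `χ(P_{k+1}) − χ(P_k)` of a dominant
  chain (signed (row, column, class)-incidence differences) satisfy NO linear relation `Σ ν_k (χ(P_{k+1}) − χ(P_k)) = 0` with ballot coefficients, because
  such a relation forces both `Σ ν_k ΔS_k = 0`-type prefix structure and `Σ ν_k ΔC_k = 0`.  Unit-step form `unit_ballot_law`.  Special cases: `ν = e_i − e_j`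
  (`i < j`): two steps of a unit-step chain never have the same valuation increment (`unit_increment_lt`, the increments strictly increase); `ν = e_a − e_b −
  e_c + e_e`-type windows: the pair-interaction / no-modular-square law of `…TropicalBChordSlack`.
* §3 **MARGINAL-COST LAW** `marginal_cost_lt`: two DISTINCT chords of equal width, `a < b`, `c < e`, `S b − S a = S e − S c`, `a < c` (overlapping allowed):
  `C b − C a < C e − C c` — the valuation cost of one and the same exponent increment strictly increases along the chain (for an odometer: the marginal cost of
  a digit is strictly increasing in the context, so a digit realised on a context-independent set of cells with context-independent displaced
  partners is impossible as soon as it is used in two contexts).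
* §4 `Design.*`: the same for `ℕ`-indexed chains of unique optima `P 0, …, P n` of a design at slopes `Θ 0 < ⋯ < Θ n`, consecutive terms distinct
  (`S i = IntervalOpt.sl d univ (P i)`, `C i = IntervalOpt.cst v univ (P i)`).
READING.  The ballot law is the Farkas dual of realisability restricted to NEIGHBOUR comparisons: a prescribed chain of terms `P_0, …, P_n` with unit
exponent steps is realisable by SOME valuations against its own neighbours iff its step vectors admit no ballot relation (the «only if» is this file;
cf. `MultiExchange.prefix_deficit`, the term-level law for arbitrary competitor families).  For radix-2 odometers it says: the `2^L − 1` step patterns are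
pairwise distinct, no later window of steps is an incidence-translate of an earlier window of the same exponent profile, and more generally the free
abelian group on (cell, class) incidences sees the chain's steps as a «ballot-free» sequence.  [this seat; Abel summation is folklore]
-/

set_option linter.dupNamespace false
set_option autoImplicit false

namespace Summit.ValiantsHypothesis.ValiantsHypothesis.Theorems.KPlusLogSqLaw

open Summit.ValiantsHypothesis.ValiantsHypothesis.Theorems.MatrixDescartes.Negative
open Finset

namespace BallotLaw

/-! ## §1 Abel summation with nonnegative prefix sums -/

/-- Abel summation: `Σ_{k ≤ n} w k · θ k = Σ_{j < n} W j · (θ j − θ (j+1)) + W n · θ n` for the prefix sums `W`. [folklore] -/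
theorem abel_prefix (w θ W : ℕ → ℚ) (hW0 : W 0 = w 0) (hWs : ∀ j, W (j + 1) = W j + w (j + 1)) :
    ∀ n : ℕ, ∑ k ∈ range (n + 1), w k * θ k = (∑ j ∈ range n, W j * (θ j - θ (j + 1))) + W n * θ n
  | 0 => by simp [hW0]
  | n + 1 => by
      rw [sum_range_succ, abel_prefix w θ W hW0 hWs n, sum_range_succ, hWs n]
      ring

/-- if the prefix sums vanish on `[0, n]` then so do the weights. [folklore] -/
theorem eq_zero_of_prefix (w W : ℕ → ℚ) (hW0 : W 0 = w 0) (hWs : ∀ j, W (j + 1) = W j + w (j + 1)) {n : ℕ}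
    (hz : ∀ j, j ≤ n → W j = 0) : ∀ k, k ≤ n → w k = 0 := by
  intro k hk
  rcases k with _ | k
  · rw [← hW0]; exact hz 0 hk
  · have h1 := hz (k + 1) hk
    have h2 := hz k (by omega)
    rw [hWs k, h2, zero_add] at h1
    exact h1

/-- some prefix sum is positive, if all are nonnegative, the last vanishes, and some weight is nonzero. [folklore] -/
theorem exists_prefix_pos (w W : ℕ → ℚ) (hW0 : W 0 = w 0) (hWs : ∀ j, W (j + 1) = W j + w (j + 1)) {n : ℕ}
    (hnn : ∀ j, j < n → 0 ≤ W j) (hlast : W n = 0) (hne : ∃ k, k ≤ n ∧ w k ≠ 0) : ∃ j, j < n ∧ 0 < W j := by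
  by_contra hcon
  push Not at hcon
  have hz : ∀ j, j ≤ n → W j = 0 := by
    intro j hj
    rcases Nat.lt_or_eq_of_le hj with h | h
    · exact le_antisymm (hcon j h) (hnn j h)
    · rw [h]; exact hlast
  obtain ⟨k, hk, hwk⟩ := hne
  exact hwk (eq_zero_of_prefix w W hW0 hWs hz k hk)

/-- **strict Abel inequality**: weights with nonnegative prefix sums, vanishing total and not all zero, summed against a STRICTLY increasing sequence,
give a negative total. [folklore] -/
theorem abel_neg (w θ W : ℕ → ℚ) (hW0 : W 0 = w 0) (hWs : ∀ j, W (j + 1) = W j + w (j + 1)) {n : ℕ}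
    (hθ : ∀ j, j < n → θ j < θ (j + 1)) (hnn : ∀ j, j < n → 0 ≤ W j) (hlast : W n = 0) (hne : ∃ k, k ≤ n ∧ w k ≠ 0) :
    ∑ k ∈ range (n + 1), w k * θ k < 0 := by
  rw [abel_prefix w θ W hW0 hWs n, hlast, zero_mul, add_zero]
  obtain ⟨j₀, hj₀, hpos⟩ := exists_prefix_pos w W hW0 hWs hnn hlast hne
  have hle : ∀ j ∈ range n, W j * (θ j - θ (j + 1)) ≤ 0 := fun j hj =>
    mul_nonpos_of_nonneg_of_nonpos (hnn j (mem_range.mp hj)) (by linarith [hθ j (mem_range.mp hj)])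
  have hlt : W j₀ * (θ j₀ - θ (j₀ + 1)) < 0 := mul_neg_of_pos_of_neg hpos (by linarith [hθ j₀ hj₀])
  calc ∑ j ∈ range n, W j * (θ j - θ (j + 1)) < ∑ j ∈ range n, (0 : ℚ) := sum_lt_sum hle ⟨j₀, mem_range.mpr hj₀, hlt⟩
    _ = 0 := sum_const_zero

/-! ## §2 The ballot law for sandwiched lattice chains -/

section Lattice

variable {n : ℕ} {Θ S C : ℕ → ℤ}
  (hΘ : ∀ i, i < n → Θ i < Θ (i + 1))
  (hsw : ∀ i, i < n → Θ i * (S (i + 1) - S i) < C (i + 1) - C i ∧ C (i + 1) - C i < Θ (i + 1) * (S (i + 1) - S i))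
include hΘ hsw

/-- the SECANT SLOPES `ΔCᵢ / ΔSᵢ` strictly increase (`NewtonPolygon.cross_lt`, rational form). [folklore] -/
theorem secant_lt {i : ℕ} (hi : i + 1 < n) :
    ((C (i + 1) - C i : ℤ) : ℚ) / (S (i + 1) - S i : ℤ) < ((C (i + 2) - C (i + 1) : ℤ) : ℚ) / (S (i + 2) - S (i + 1) : ℤ) := by
  have h1 := NewtonPolygon.step_pos hΘ hsw (i := i) (by omega)
  have h2 := NewtonPolygon.step_pos hΘ hsw (i := i + 1) hi
  have hc := NewtonPolygon.cross_lt hΘ hsw (i := i) (j := i + 1) (lt_add_one i) hi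
  have e : i + 1 + 1 = i + 2 := by ring
  rw [e] at h2 hc
  rw [div_lt_div_iff₀ (by exact_mod_cast sub_pos.mpr h1) (by exact_mod_cast sub_pos.mpr h2)]
  exact_mod_cast hc

/-- **BALLOT LAW.**  Let `ν : ℕ → ℤ` be coefficients on the steps `0, …, n−1` of a sandwiched chain (`1 ≤ n`) whose weighted prefix sums
`W j = Σ_{k ≤ j} ν k · ΔS_k` are `≥ 0` for `j < n − 1` and vanish at `j = n − 1`, with `ν k ≠ 0` for some step.  Then `Σ_{k < n} ν k · ΔC_k < 0`.
[this seat] -/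
theorem ballot_law (hn : 1 ≤ n) (ν : ℕ → ℤ)
    (hpre : ∀ j, j + 1 < n → 0 ≤ ∑ k ∈ range (j + 1), ν k * (S (k + 1) - S k))
    (htot : ∑ k ∈ range n, ν k * (S (k + 1) - S k) = 0)
    (hne : ∃ k, k < n ∧ ν k ≠ 0) :
    ∑ k ∈ range n, ν k * (C (k + 1) - C k) < 0 := by
  -- weights `w k = ν k ΔS_k`, sequence `θ k = ΔC_k / ΔS_k`, prefix sums `W`
  set w : ℕ → ℚ := fun k => ((ν k * (S (k + 1) - S k) : ℤ) : ℚ) with hw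
  set θ : ℕ → ℚ := fun k => ((C (k + 1) - C k : ℤ) : ℚ) / (S (k + 1) - S k : ℤ) with hθdef
  set W : ℕ → ℚ := fun j => ∑ k ∈ range (j + 1), w k with hWdef
  have hW0 : W 0 = w 0 := by simp [hWdef]
  have hWs : ∀ j, W (j + 1) = W j + w (j + 1) := fun j => by simp only [hWdef]; rw [sum_range_succ]
  obtain ⟨n', rfl⟩ : ∃ n', n = n' + 1 := ⟨n - 1, by omega⟩
  -- `w k θ k = ν k ΔC_k`
  have hwθ : ∀ k, k < n' + 1 → w k * θ k = ((ν k * (C (k + 1) - C k) : ℤ) : ℚ) := by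
    intro k hk
    have hs : ((S (k + 1) - S k : ℤ) : ℚ) ≠ 0 := by
      exact_mod_cast (sub_pos.mpr (NewtonPolygon.step_pos hΘ hsw (i := k) hk)).ne'
    have hs' : ((S (k + 1) : ℤ) : ℚ) - (S k : ℤ) ≠ 0 := by push_cast at hs; exact hs
    simp only [hw, hθdef]
    push_cast
    rw [mul_assoc, mul_comm (((S (k + 1) : ℤ) : ℚ) - (S k : ℤ)) _, div_mul_cancel₀ _ hs']
  have hsum : ∑ k ∈ range (n' + 1), w k * θ k = ((∑ k ∈ range (n' + 1), ν k * (C (k + 1) - C k) : ℤ) : ℚ) := by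
    push_cast
    exact sum_congr rfl fun k hk => by rw [hwθ k (mem_range.mp hk)]; push_cast; ring
  have key := abel_neg w θ W hW0 hWs (n := n')
    (fun j hj => secant_lt hΘ hsw (i := j) (by omega))
    (fun j hj => by
      simp only [hWdef, hw]
      have := hpre j (by omega)
      exact_mod_cast this)
    (by
      simp only [hWdef, hw]
      exact_mod_cast htot)
    (by
      obtain ⟨k, hk, hνk⟩ := hne
      refine ⟨k, by omega, ?_⟩
      simp only [hw]
      have hs : (S (k + 1) - S k : ℤ) ≠ 0 := (sub_pos.mpr (NewtonPolygon.step_pos hΘ hsw (i := k) hk)).ne'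
      exact_mod_cast mul_ne_zero hνk hs)
  rw [hsum] at key
  exact_mod_cast key

/-- **no ballot relation**: with `ν` as in `ballot_law`, `Σ_{k<n} ν k · ΔC_k ≠ 0`. [this seat] -/
theorem no_ballot_relation (hn : 1 ≤ n) (ν : ℕ → ℤ)
    (hpre : ∀ j, j + 1 < n → 0 ≤ ∑ k ∈ range (j + 1), ν k * (S (k + 1) - S k))
    (htot : ∑ k ∈ range n, ν k * (S (k + 1) - S k) = 0)
    (hne : ∃ k, k < n ∧ ν k ≠ 0) :
    ∑ k ∈ range n, ν k * (C (k + 1) - C k) ≠ 0 :=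
  (ballot_law hΘ hsw hn ν hpre htot hne).ne

/-- **unit-step ballot law**: on a unit-step chain (`ΔS ≡ 1`) the hypotheses are on the plain prefix sums of `ν`. [this seat] -/
theorem unit_ballot_law (hunit : ∀ i, i < n → S (i + 1) - S i = 1) (hn : 1 ≤ n) (ν : ℕ → ℤ)
    (hpre : ∀ j, j + 1 < n → 0 ≤ ∑ k ∈ range (j + 1), ν k) (htot : ∑ k ∈ range n, ν k = 0) (hne : ∃ k, k < n ∧ ν k ≠ 0) :
    ∑ k ∈ range n, ν k * (C (k + 1) - C k) < 0 := by
  refine ballot_law hΘ hsw hn ν (fun j hj => ?_) ?_ hne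
  · rw [sum_congr rfl fun k hk => by rw [hunit k (by have := mem_range.mp hk; omega), mul_one]]
    exact hpre j hj
  · rw [sum_congr rfl fun k hk => by rw [hunit k (mem_range.mp hk), mul_one]]
    exact htot

/-- special case `ν = e_i − e_j`: on a unit-step chain the valuation increments strictly increase, `ΔC_i < ΔC_j` for steps `i < j`. [this seat] -/
theorem unit_increment_lt (hunit : ∀ i, i < n → S (i + 1) - S i = 1) {i j : ℕ} (hij : i < j) (hj : j < n) :
    C (i + 1) - C i < C (j + 1) - C j := by
  classical
  have key := unit_ballot_law hΘ hsw hunit (by omega) (fun k => if k = i then 1 else if k = j then -1 else 0)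
    (fun j' hj' => by
      -- prefix sums of `e_i − e_j` are `0` before `i`, `1` on `[i, j)`, `0` from `j` on
      by_cases h1 : i < j' + 1
      · by_cases h2 : j < j' + 1
        · rw [sum_ite, sum_ite]
          simp only [sum_const, nsmul_eq_mul, mul_one, mul_neg, mul_zero, add_zero, filter_filter]
          have ei : (filter (fun x => x = i) (range (j' + 1))).card = 1 := by
            rw [filter_eq' (range (j' + 1)) i, if_pos (mem_range.mpr h1), card_singleton]
          have ej : (filter (fun a => ¬a = i ∧ a = j) (range (j' + 1))).card = 1 := by
            have : filter (fun a => ¬a = i ∧ a = j) (range (j' + 1)) = {j} := by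
              ext a; simp only [mem_filter, mem_range, mem_singleton]; omega
            rw [this, card_singleton]
          rw [ei, ej]; norm_num
        · rw [sum_ite, sum_ite]
          simp only [sum_const, nsmul_eq_mul, mul_one, mul_neg, mul_zero, add_zero, filter_filter]
          have ei : (filter (fun x => x = i) (range (j' + 1))).card = 1 := by
            rw [filter_eq' (range (j' + 1)) i, if_pos (mem_range.mpr h1), card_singleton]
          have ej : (filter (fun a => ¬a = i ∧ a = j) (range (j' + 1))).card = 0 := by
            rw [card_eq_zero]; ext a; simp only [mem_filter, mem_range, Finset.notMem_empty, iff_false]; omega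
          rw [ei, ej]; norm_num
      · have : ∑ k ∈ range (j' + 1), (if k = i then (1 : ℤ) else if k = j then -1 else 0) = 0 := by
          refine sum_eq_zero fun k hk => ?_
          have := mem_range.mp hk
          rw [if_neg (by omega), if_neg (by omega)]
        rw [this])
    (by
      rw [sum_ite, sum_ite]
      simp only [sum_const, nsmul_eq_mul, mul_one, mul_neg, mul_zero, add_zero, filter_filter]
      have ei : (filter (fun x => x = i) (range n)).card = 1 := by
        rw [filter_eq' (range n) i, if_pos (mem_range.mpr (by omega)), card_singleton]
      have ej : (filter (fun a => ¬a = i ∧ a = j) (range n)).card = 1 := by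
        have : filter (fun a => ¬a = i ∧ a = j) (range n) = {j} := by
          ext a; simp only [mem_filter, mem_range, mem_singleton]; omega
        rw [this, card_singleton]
      rw [ei, ej]; norm_num)
    ⟨i, by omega, by simp⟩
  -- evaluate the weighted sum: `ΔC_i − ΔC_j < 0`
  have hev : ∑ k ∈ range n, (if k = i then (1 : ℤ) else if k = j then -1 else 0) * (C (k + 1) - C k) =
      (C (i + 1) - C i) - (C (j + 1) - C j) := by
    have hsplit : ∀ k ∈ range n, (if k = i then (1 : ℤ) else if k = j then -1 else 0) * (C (k + 1) - C k) =
        (if k = i then (C (k + 1) - C k) else 0) + (if k = j then -(C (k + 1) - C k) else 0) := by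
      intro k _
      by_cases hki : k = i
      · subst hki; rw [if_pos rfl, if_pos rfl, if_neg (by omega)]; ring
      · rw [if_neg hki, if_neg hki]
        by_cases hkj : k = j
        · subst hkj; rw [if_pos rfl, if_pos rfl]; ring
        · rw [if_neg hkj, if_neg hkj]; ring
    rw [sum_congr rfl hsplit, sum_add_distrib, sum_ite_eq' (range n) i, sum_ite_eq' (range n) j,
      if_pos (mem_range.mpr (by omega)), if_pos (mem_range.mpr hj)]
    ring
  rw [hev] at key
  linarith

/-! ## §3 The marginal-cost law (equal chords, overlapping allowed) -/

/-- **MARGINAL-COST LAW**: two distinct chords of the same width, `a < b`, `c < e`, `S b − S a = S e − S c`, the second starting later (`a < c`),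
have `C b − C a < C e − C c` — whether or not they overlap. [this seat] -/
theorem marginal_cost_lt {a b c e : ℕ} (hab : a < b) (hce : c < e) (hac : a < c) (he : e ≤ n) (hb : b ≤ n)
    (hW : S b - S a = S e - S c) : C b - C a < C e - C c := by
  have hmono : StrictMonoOn S (Set.Iic n) := by
    intro i hi j hj hij
    have := NewtonPolygon.mono_of_succ_lt (Θ := S) (fun k hk => NewtonPolygon.step_pos hΘ hsw hk) (Nat.succ_le_of_lt hij) hj
    have h2 := NewtonPolygon.step_pos hΘ hsw (i := i) (by simp only [Set.mem_Iic] at hj; omega)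
    linarith
  -- `b < e`: equal widths and `a < c` force the second chord to end later
  have hbe : b < e := by
    by_contra h
    push Not at h
    have h1 : S e ≤ S b := hmono.monotoneOn (by simp; omega) (by simp; omega) h
    have h2 : S a < S c := hmono (by simp; omega) (by simp; omega) hac
    linarith
  rcases Nat.lt_or_ge c b with hcb | hbc
  · -- overlapping chords: `a < c < b < e`; compare the chords `[a, c]` and `[b, e]`, also of equal width
    have hW' : S c - S a = S e - S b := by linarith
    have h1 : C c - C a + 1 ≤ Θ c * (S c - S a) := chord_upper hΘ hsw hac (by omega)
    have h2 : Θ b * (S e - S b) + 1 ≤ C e - C b := chord_lower hΘ hsw hbe he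
    have hθ : Θ c ≤ Θ b := NewtonPolygon.mono_of_succ_lt hΘ hcb.le hb
    have hWpos : 0 < S c - S a := by have := hmono (by simp; omega) (by simp; omega) hac; linarith
    rw [← hW'] at h2
    nlinarith
  · -- disjoint chords: `a < b ≤ c < e`
    have h1 : C b - C a + 1 ≤ Θ b * (S b - S a) := by
      have := (hsw a (by omega)).2
      -- chord law via the ChordSlack-free route: sum the sandwich; we re-derive the two chord inequalities locally
      exact chord_upper hΘ hsw hab hb
    have h2 : Θ c * (S e - S c) + 1 ≤ C e - C c := chord_lower hΘ hsw hce he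
    have hθ : Θ b ≤ Θ c := NewtonPolygon.mono_of_succ_lt hΘ hbc (by omega)
    have hWpos : 0 < S b - S a := by have := hmono (by simp; omega) (by simp; omega) hab; linarith
    rw [← hW] at h2
    nlinarith
  where
  /-- chord law, upper half (local copy): `C j − C i < Θ j (S j − S i)` for `i < j ≤ n`. -/
  chord_upper {Θ S C : ℕ → ℤ} {n : ℕ} (hΘ : ∀ i, i < n → Θ i < Θ (i + 1))
      (hsw : ∀ i, i < n → Θ i * (S (i + 1) - S i) < C (i + 1) - C i ∧ C (i + 1) - C i < Θ (i + 1) * (S (i + 1) - S i))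
      {i j : ℕ} (hij : i < j) (hj : j ≤ n) : C j - C i + 1 ≤ Θ j * (S j - S i) := by
    induction j, hij using Nat.le_induction with
    | base =>
        have := (hsw i (by omega)).2
        linarith
    | succ j hij ih =>
        have h1 := ih (by omega)
        have h2 := (hsw j (by omega)).2
        have h3 : Θ j ≤ Θ (j + 1) := (hΘ j (by omega)).le
        have h4 : S i ≤ S j := NewtonPolygon.mono_of_succ_lt (Θ := S) (fun k hk => NewtonPolygon.step_pos hΘ hsw hk) (by omega) (by omega)
        have h5 : Θ j * (S j - S i) ≤ Θ (j + 1) * (S j - S i) := mul_le_mul_of_nonneg_right h3 (by linarith)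
        nlinarith
  /-- chord law, lower half (local copy): `Θ i (S j − S i) < C j − C i` for `i < j ≤ n`. -/
  chord_lower {Θ S C : ℕ → ℤ} {n : ℕ} (hΘ : ∀ i, i < n → Θ i < Θ (i + 1))
      (hsw : ∀ i, i < n → Θ i * (S (i + 1) - S i) < C (i + 1) - C i ∧ C (i + 1) - C i < Θ (i + 1) * (S (i + 1) - S i))
      {i j : ℕ} (hij : i < j) (hj : j ≤ n) : Θ i * (S j - S i) + 1 ≤ C j - C i := by
    induction j, hij using Nat.le_induction with
    | base =>
        have := (hsw i (by omega)).1
        linarith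
    | succ j hij ih =>
        have h1 := ih (by omega)
        have h2 := (hsw j (by omega)).1
        have h3 : Θ i ≤ Θ j := NewtonPolygon.mono_of_succ_lt hΘ (by omega) (by omega)
        have h4 := NewtonPolygon.step_pos hΘ hsw (i := j) (by omega)
        have h5 : Θ i * (S (j + 1) - S j) ≤ Θ j * (S (j + 1) - S j) := mul_le_mul_of_nonneg_right h3 (by linarith)
        nlinarith

end Lattice

/-! ## §4 Dominant chains of a design -/

namespace Design

variable {m K : ℕ} (d : Fin K → ℕ) (v ε : Fin m → Fin m → Fin K → ℤ)
  {n : ℕ} {Θ : ℕ → ℤ} {P : ℕ → Equiv.Perm (Fin m) × (Fin m → Fin K)}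
  (hΘ : ∀ i, i < n → Θ i < Θ (i + 1)) (hdom : ∀ i, i ≤ n → IsDominant d v ε (Θ i) (P i)) (hne : ∀ i, i < n → P i ≠ P (i + 1))
include hΘ hdom hne

/-- **BALLOT LAW for dominant chains**: for step coefficients `ν` with nonnegative exponent-weighted prefix sums
`Σ_{k ≤ j} ν k·(s (k+1) − s k)` (`j + 1 < n`), vanishing total, and some `ν k ≠ 0`, the weighted sum of VALUATION increments is negative:
`Σ_{k<n} ν k·(V (k+1) − V k) < 0`. [this seat] -/
theorem ballot_law (hn : 1 ≤ n) (ν : ℕ → ℤ)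
    (hpre : ∀ j, j + 1 < n → 0 ≤ ∑ k ∈ range (j + 1), ν k * (IntervalOpt.sl d univ (P (k + 1)) - IntervalOpt.sl d univ (P k)))
    (htot : ∑ k ∈ range n, ν k * (IntervalOpt.sl d univ (P (k + 1)) - IntervalOpt.sl d univ (P k)) = 0)
    (hνne : ∃ k, k < n ∧ ν k ≠ 0) :
    ∑ k ∈ range n, ν k * (IntervalOpt.cst v univ (P (k + 1)) - IntervalOpt.cst v univ (P k)) < 0 :=
  BallotLaw.ballot_law (S := fun i => IntervalOpt.sl d univ (P i)) (C := fun i => IntervalOpt.cst v univ (P i))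
    hΘ (fun _ hi => NewtonPolygon.sandwich d v ε hdom hne hi) hn ν hpre htot hνne

/-- **no ballot relation among the step vectors of a dominant chain**: a linear relation with ballot coefficients would give both sums `= 0`.
[this seat] -/
theorem no_ballot_relation (hn : 1 ≤ n) (ν : ℕ → ℤ)
    (hpre : ∀ j, j + 1 < n → 0 ≤ ∑ k ∈ range (j + 1), ν k * (IntervalOpt.sl d univ (P (k + 1)) - IntervalOpt.sl d univ (P k)))
    (htot : ∑ k ∈ range n, ν k * (IntervalOpt.sl d univ (P (k + 1)) - IntervalOpt.sl d univ (P k)) = 0)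
    (hνne : ∃ k, k < n ∧ ν k ≠ 0) :
    ∑ k ∈ range n, ν k * (IntervalOpt.cst v univ (P (k + 1)) - IntervalOpt.cst v univ (P k)) ≠ 0 :=
  (ballot_law d v ε hΘ hdom hne hn ν hpre htot hνne).ne

/-- **MARGINAL-COST LAW for dominant chains**: the same exponent increment costs strictly more valuation later in the chain — for chords
`a < b`, `c < e` of equal exponent width with `a < c` (overlapping or not), `V b − V a < V e − V c`. [this seat] -/
theorem marginal_cost_lt {a b c e : ℕ} (hab : a < b) (hce : c < e) (hac : a < c) (he : e ≤ n) (hb : b ≤ n)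
    (hW : IntervalOpt.sl d univ (P b) - IntervalOpt.sl d univ (P a) = IntervalOpt.sl d univ (P e) - IntervalOpt.sl d univ (P c)) :
    IntervalOpt.cst v univ (P b) - IntervalOpt.cst v univ (P a) < IntervalOpt.cst v univ (P e) - IntervalOpt.cst v univ (P c) :=
  BallotLaw.marginal_cost_lt (S := fun i => IntervalOpt.sl d univ (P i)) (C := fun i => IntervalOpt.cst v univ (P i))
    hΘ (fun _ hi => NewtonPolygon.sandwich d v ε hdom hne hi) hab hce hac he hb hW

end Design

end BallotLaw

end Summit.ValiantsHypothesis.ValiantsHypothesis.Theorems.KPlusLogSqLaw
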